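import Literature.Geometry.Riemannian.PinchingEstimatesKyFanMax
import Literature.Geometry.Riemannian.PinchingEstimatesTwoLargestCore
import HarnessLib

/-!
# Hamilton 1997, Thm. 1.3 at the extremal frames: the pointwise differential inequality
(topic `Geometry/Riemannian`)

Part of the decomposition of `Literature.Geometry.Riemannian.hamilton_chenZhu_pinching`
(`PinchingEstimates.lean`). Hamilton 1997, §2.1, Thm. 1.3 (p. 7): "There exist a constant
`Λ < ∞` depending only on the initial metric such that `(b₂ + b₃)² ≤ Λ(a₁ + a₂)(c₁ + c₂)`"
is preserved, with the proof (p. 8): `d/dt ln(b₂ + b₃) ≤ a₃ + c₃ + 2b₁`,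
`d/dt ln(a₁ + a₂) ≥ 2a₃ + 2b₁ + (a₁² + a₂² + b₁² + b₂² - 2b₁(a₁ + a₂))/(a₁ + a₂)`, the last
numerator being `≥ 0`, and likewise for `c₁ + c₂`; hence the ratio is non-increasing.

In the tree's variational language (`HamiltonODE.SingularValuesSumSqLE`) the preserved
quantity is the minimum over `pairSet⁴` of `G = Λ X(w, w') X_C(z, z') - Y²`,
`Y = u₁ᵀBv₁ + u₂ᵀBv₂`; at a minimiser `(w, w')`, `(z, z')` minimise the pair sums of `A`, `C`
and the frames `(u₁, u₂; v₁, v₂)` maximise `Y` (after a sign flip), and after a simultaneous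
rotation the block `uᵢᵀBvⱼ` is diagonal (`PinchingEstimatesKyFanMax.lean`). PROVED here:

* `kyFanMax_upper` — `Y' ≤ (Mᴬ + Mᶜ + 2|κ|) Y` at a diagonal maximiser (Hamilton's
  `a₃ + c₃ + 2b₁`, with `κ = u₀ᵀBv₀` in the role of `±b₁` and `Mᴬ, Mᶜ` the top Rayleigh
  quotients);
* `normSq_ge_kappa_sq` — `|ᵗBe|² ≥ κ²` and `|Be|² ≥ κ²` for unit `e` (`b₁` is the least singular
  value);
* `pairMin_lower` — `X' ≥ 2(Mᴬ + |κ|) X` at the minimising pair (Hamilton's lower bound with the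
  non-negative numerator dropped);
* `twoSingular_deriv_ge` — the bookkeeping `Λ(X'X_C + XX_C') - 2YY' ≥ 2(Mᴬ + Mᶜ + 2|κ|) · G`.

## References

* R. S. Hamilton, Comm. Anal. Geom. 5 (1997), §2.1, Thm. 1.3 and its proof (pp. 7–8). [Hamilton1997]
* R. S. Hamilton, J. Differential Geom. 24 (1986), §6, Lemma 6.1 (p. 167). [Hamilton1986]
-/

noncomputable section

open Set Real
open scoped Matrix BigOperators

namespace Literature.Geometry.Riemannian

namespace HamiltonODE

variable {A B C : Matrix (Fin 3) (Fin 3) ℝ}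

section Max

variable {u₁ u₂ v₁ v₂ : Fin 3 → ℝ} (hu₁ : u₁ ⬝ᵥ u₁ = 1) (hu₂ : u₂ ⬝ᵥ u₂ = 1) (hu : u₁ ⬝ᵥ u₂ = 0)
  (hv₁ : v₁ ⬝ᵥ v₁ = 1) (hv₂ : v₂ ⬝ᵥ v₂ = 1) (hv : v₁ ⬝ᵥ v₂ = 0)
  (hmax : ∀ u₁' u₂' v₁' v₂' : Fin 3 → ℝ, u₁' ⬝ᵥ u₁' = 1 → u₂' ⬝ᵥ u₂' = 1 → u₁' ⬝ᵥ u₂' = 0 →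
    v₁' ⬝ᵥ v₁' = 1 → v₂' ⬝ᵥ v₂' = 1 → v₁' ⬝ᵥ v₂' = 0 →
    u₁' ⬝ᵥ (B *ᵥ v₁') + u₂' ⬝ᵥ (B *ᵥ v₂') ≤ u₁ ⬝ᵥ (B *ᵥ v₁) + u₂ ⬝ᵥ (B *ᵥ v₂))
  (hdiag : u₁ ⬝ᵥ (B *ᵥ v₂) = 0)
include hu₁ hu₂ hu hv₁ hv₂ hv hmax

omit hu₁ hu₂ hu hv₁ hv₂ hv in
/-- The transposed configuration maximises the Ky Fan sum of `ᵗB`. [folklore] -/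
theorem kyFanMax_transpose : ∀ v₁' v₂' u₁' u₂' : Fin 3 → ℝ, v₁' ⬝ᵥ v₁' = 1 → v₂' ⬝ᵥ v₂' = 1 →
    v₁' ⬝ᵥ v₂' = 0 → u₁' ⬝ᵥ u₁' = 1 → u₂' ⬝ᵥ u₂' = 1 → u₁' ⬝ᵥ u₂' = 0 →
    v₁' ⬝ᵥ (Bᵀ *ᵥ u₁') + v₂' ⬝ᵥ (Bᵀ *ᵥ u₂') ≤ v₁ ⬝ᵥ (Bᵀ *ᵥ u₁) + v₂ ⬝ᵥ (Bᵀ *ᵥ u₂) := by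
  intro v₁' v₂' u₁' u₂' hv₁' hv₂' hv' hu₁' hu₂' hu'
  simp only [Matrix.dotProduct_transpose_mulVec]
  exact hmax u₁' u₂' v₁' v₂' hu₁' hu₂' hu' hv₁' hv₂' hv'

include hdiag

/-- **`Y' ≤ (Mᴬ + Mᶜ + 2|κ|) Y` at a diagonal maximiser** (Hamilton: `d(b₂ + b₃)/dt ≤
(a₃ + c₃ + 2b₁)(b₂ + b₃)`): for any `A, C` and any `Mᴬ` dominating the Rayleigh quotients of
`A` and `Mᶜ` those of `C`. [cite: Hamilton1997, §2.1, Thm. 1.3 (proof, p. 8)] -/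
theorem kyFanMax_upper {MA MC : ℝ}
    (hMA : ∀ e : Fin 3 → ℝ, e ⬝ᵥ e = 1 → e ⬝ᵥ (A *ᵥ e) ≤ MA)
    (hMC : ∀ e : Fin 3 → ℝ, e ⬝ᵥ e = 1 → e ⬝ᵥ (C *ᵥ e) ≤ MC) :
    u₁ ⬝ᵥ ((A * B + B * C + (2 : ℝ) • B.sharp) *ᵥ v₁) + u₂ ⬝ᵥ ((A * B + B * C + (2 : ℝ) • B.sharp) *ᵥ v₂)
      ≤ (MA + MC + 2 * |(u₁ ⨯₃ u₂) ⬝ᵥ (B *ᵥ (v₁ ⨯₃ v₂))|) * (u₁ ⬝ᵥ (B *ᵥ v₁) + u₂ ⬝ᵥ (B *ᵥ v₂)) := by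
  have hB1 := kyFanMax_mulVec_fst hu₁ hu₂ hu hv₁ hv₂ hv hmax
  have hB2 := kyFanMax_mulVec_snd hu₁ hu₂ hu hv₁ hv₂ hv hmax
  rw [hdiag] at hB1 hB2
  -- `ᵗBu₁ = M₁₁ v₁`, `ᵗBu₂ = M₂₂ v₂` (transposed configuration)
  have hmaxT := kyFanMax_transpose hmax
  have hT1 := kyFanMax_mulVec_fst (B := Bᵀ) hv₁ hv₂ hv hu₁ hu₂ hu hmaxT
  have hT2 := kyFanMax_mulVec_snd (B := Bᵀ) hv₁ hv₂ hv hu₁ hu₂ hu hmaxT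
  have hsymm := kyFanMax_symm hu₁ hu₂ hu hv₁ hv₂ hv hmax
  simp only [Matrix.dotProduct_transpose_mulVec] at hT1 hT2
  rw [hsymm, hdiag] at hT1 hT2
  simp only [zero_smul, add_zero, zero_add] at hB1 hB2 hT1 hT2
  -- the `B^#`-terms
  have hsharp := kyFanMax_sharp_sum hu₁ hu₂ hu hv₁ hv₂ hv hmax
  have hd1 := kyFanMax_diag_nonneg_fst hu₁ hu₂ hu hv₁ hv₂ hv hmax
  have hd2 := kyFanMax_diag_nonneg_snd hu₁ hu₂ hu hv₁ hv₂ hv hmax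
  -- abbreviate the diagonal entries
  set μ₁ := u₁ ⬝ᵥ (B *ᵥ v₁) with hμ₁
  set μ₂ := u₂ ⬝ᵥ (B *ᵥ v₂) with hμ₂
  -- expand the three terms for each `i`
  have a1 : u₁ ⬝ᵥ ((A * B) *ᵥ v₁) = μ₁ * (u₁ ⬝ᵥ (A *ᵥ u₁)) := by
    rw [← Matrix.mulVec_mulVec, hB1, Matrix.mulVec_smul, dotProduct_smul, smul_eq_mul]
  have a2 : u₂ ⬝ᵥ ((A * B) *ᵥ v₂) = μ₂ * (u₂ ⬝ᵥ (A *ᵥ u₂)) := by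
    rw [← Matrix.mulVec_mulVec, hB2, Matrix.mulVec_smul, dotProduct_smul, smul_eq_mul]
  have c1 : u₁ ⬝ᵥ ((B * C) *ᵥ v₁) = μ₁ * (v₁ ⬝ᵥ (C *ᵥ v₁)) := by
    rw [← Matrix.mulVec_mulVec, Matrix.dotProduct_mulVec, ← Matrix.mulVec_transpose, hT1, smul_dotProduct,
      smul_eq_mul]
  have c2 : u₂ ⬝ᵥ ((B * C) *ᵥ v₂) = μ₂ * (v₂ ⬝ᵥ (C *ᵥ v₂)) := by
    rw [← Matrix.mulVec_mulVec, Matrix.dotProduct_mulVec, ← Matrix.mulVec_transpose, hT2, smul_dotProduct,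
      smul_eq_mul]
  have s1 : u₁ ⬝ᵥ (((2 : ℝ) • B.sharp) *ᵥ v₁) = 2 * (u₁ ⬝ᵥ (B.sharp *ᵥ v₁)) := by
    rw [Matrix.smul_mulVec, dotProduct_smul, smul_eq_mul]
  have s2 : u₂ ⬝ᵥ (((2 : ℝ) • B.sharp) *ᵥ v₂) = 2 * (u₂ ⬝ᵥ (B.sharp *ᵥ v₂)) := by
    rw [Matrix.smul_mulVec, dotProduct_smul, smul_eq_mul]
  have e1 : u₁ ⬝ᵥ ((A * B + B * C + (2 : ℝ) • B.sharp) *ᵥ v₁) =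
      μ₁ * (u₁ ⬝ᵥ (A *ᵥ u₁)) + μ₁ * (v₁ ⬝ᵥ (C *ᵥ v₁)) + 2 * (u₁ ⬝ᵥ (B.sharp *ᵥ v₁)) := by
    rw [Matrix.add_mulVec, Matrix.add_mulVec, dotProduct_add, dotProduct_add, a1, c1, s1]
  have e2 : u₂ ⬝ᵥ ((A * B + B * C + (2 : ℝ) • B.sharp) *ᵥ v₂) =
      μ₂ * (u₂ ⬝ᵥ (A *ᵥ u₂)) + μ₂ * (v₂ ⬝ᵥ (C *ᵥ v₂)) + 2 * (u₂ ⬝ᵥ (B.sharp *ᵥ v₂)) := by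
    rw [Matrix.add_mulVec, Matrix.add_mulVec, dotProduct_add, dotProduct_add, a2, c2, s2]
  rw [e1, e2]
  have hA1 := hMA u₁ hu₁
  have hA2 := hMA u₂ hu₂
  have hC1 := hMC v₁ hv₁
  have hC2 := hMC v₂ hv₂
  have hk : ((u₁ ⨯₃ u₂) ⬝ᵥ (B *ᵥ (v₁ ⨯₃ v₂))) * (μ₁ + μ₂) ≤
      |(u₁ ⨯₃ u₂) ⬝ᵥ (B *ᵥ (v₁ ⨯₃ v₂))| * (μ₁ + μ₂) :=
    mul_le_mul_of_nonneg_right (le_abs_self _) (by linarith)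
  have hs : 2 * (u₁ ⬝ᵥ (B.sharp *ᵥ v₁)) + 2 * (u₂ ⬝ᵥ (B.sharp *ᵥ v₂)) =
      2 * (((u₁ ⨯₃ u₂) ⬝ᵥ (B *ᵥ (v₁ ⨯₃ v₂))) * (μ₁ + μ₂)) := by
    rw [← hsharp]; ring
  nlinarith [mul_le_mul_of_nonneg_left hA1 hd1, mul_le_mul_of_nonneg_left hA2 hd2,
    mul_le_mul_of_nonneg_left hC1 hd1, mul_le_mul_of_nonneg_left hC2 hd2]

/-- **`|ᵗBe|² ≥ κ²` for every unit `e`** at a diagonal maximiser (`b₁` is the least singular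
value). [folklore] -/
theorem normSq_transpose_ge_kappa_sq (e : Fin 3 → ℝ) (he : e ⬝ᵥ e = 1) :
    ((u₁ ⨯₃ u₂) ⬝ᵥ (B *ᵥ (v₁ ⨯₃ v₂))) ^ 2 ≤ (Bᵀ *ᵥ e) ⬝ᵥ (Bᵀ *ᵥ e) := by
  set κ := (u₁ ⨯₃ u₂) ⬝ᵥ (B *ᵥ (v₁ ⨯₃ v₂)) with hκ
  have hn1 : (u₁ ⨯₃ u₂) ⬝ᵥ (u₁ ⨯₃ u₂) = 1 := dotProduct_cross_self_of_orthonormal hu₁ hu₂ hu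
  have hm1 : (v₁ ⨯₃ v₂) ⬝ᵥ (v₁ ⨯₃ v₂) = 1 := dotProduct_cross_self_of_orthonormal hv₁ hv₂ hv
  have hu₁n : u₁ ⬝ᵥ (u₁ ⨯₃ u₂) = 0 := dot_self_cross u₁ u₂
  have hu₂n : u₂ ⬝ᵥ (u₁ ⨯₃ u₂) = 0 := dot_cross_self u₁ u₂
  have hv₁n : v₁ ⬝ᵥ (v₁ ⨯₃ v₂) = 0 := dot_self_cross v₁ v₂
  have hv₂n : v₂ ⬝ᵥ (v₁ ⨯₃ v₂) = 0 := dot_cross_self v₁ v₂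
  -- `ᵗBu₁ = M₁₁ v₁`, `ᵗBu₂ = M₂₂ v₂`, `ᵗBu₀ = κ v₀`
  have hmaxT := kyFanMax_transpose hmax
  have hT1 := kyFanMax_mulVec_fst (B := Bᵀ) hv₁ hv₂ hv hu₁ hu₂ hu hmaxT
  have hT2 := kyFanMax_mulVec_snd (B := Bᵀ) hv₁ hv₂ hv hu₁ hu₂ hu hmaxT
  have hT0 := kyFanMax_mulVec_normal (B := Bᵀ) hv₁ hv₂ hv hu₁ hu₂ hu hmaxT
  have hsymm := kyFanMax_symm hu₁ hu₂ hu hv₁ hv₂ hv hmax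
  simp only [Matrix.dotProduct_transpose_mulVec] at hT1 hT2 hT0
  rw [hsymm, hdiag] at hT1 hT2
  have hT0' : Bᵀ *ᵥ (u₁ ⨯₃ u₂) = κ • (v₁ ⨯₃ v₂) := hT0
  -- expand `e` and compute `ᵗBe`
  have hexp := expand_orthonormal hu₁ hu₂ hn1 hu hu₁n hu₂n e
  have hBe : Bᵀ *ᵥ e = ((u₁ ⬝ᵥ e) * (u₁ ⬝ᵥ (B *ᵥ v₁))) • v₁ + ((u₂ ⬝ᵥ e) * (u₂ ⬝ᵥ (B *ᵥ v₂))) • v₂ +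
      ((u₁ ⨯₃ u₂ ⬝ᵥ e) * κ) • (v₁ ⨯₃ v₂) := by
    conv_lhs => rw [hexp]
    rw [Matrix.mulVec_add, Matrix.mulVec_add, Matrix.mulVec_smul, Matrix.mulVec_smul, Matrix.mulVec_smul,
      hT1, hT2, hT0']
    simp only [zero_smul, add_zero, zero_add, smul_smul]
  have hPe := parseval_of_orthonormal hu₁ hu₂ hn1 hu hu₁n hu₂n e
  rw [he] at hPe
  have hn : (Bᵀ *ᵥ e) ⬝ᵥ (Bᵀ *ᵥ e) = ((u₁ ⬝ᵥ e) * (u₁ ⬝ᵥ (B *ᵥ v₁))) ^ 2 +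
      ((u₂ ⬝ᵥ e) * (u₂ ⬝ᵥ (B *ᵥ v₂))) ^ 2 + ((u₁ ⨯₃ u₂ ⬝ᵥ e) * κ) ^ 2 := by
    rw [hBe]
    simp only [dotProduct_add, add_dotProduct, dotProduct_smul, smul_dotProduct, smul_eq_mul, hv₁, hv₂, hm1,
      hv, hv₁n, hv₂n, dotProduct_comm v₂ v₁, dotProduct_comm (v₁ ⨯₃ v₂) v₁, dotProduct_comm (v₁ ⨯₃ v₂) v₂]
    ring
  rw [hn]
  have hk1 := kyFanMax_kappa_le_fst hu₁ hu₂ hu hv₁ hv₂ hv hmax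
  have hk2 := kyFanMax_kappa_le_snd hu₁ hu₂ hu hv₁ hv₂ hv hmax
  have h1 : κ ^ 2 ≤ (u₁ ⬝ᵥ (B *ᵥ v₁)) ^ 2 := by
    rw [← sq_abs κ]; exact pow_le_pow_left₀ (abs_nonneg _) hk1 2
  have h2 : κ ^ 2 ≤ (u₂ ⬝ᵥ (B *ᵥ v₂)) ^ 2 := by
    rw [← sq_abs κ]; exact pow_le_pow_left₀ (abs_nonneg _) hk2 2
  nlinarith [mul_le_mul_of_nonneg_left h1 (sq_nonneg (u₁ ⬝ᵥ e)),
    mul_le_mul_of_nonneg_left h2 (sq_nonneg (u₂ ⬝ᵥ e)), sq_nonneg (u₁ ⨯₃ u₂ ⬝ᵥ e)]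

end Max

/-- **`|Be|² ≥ κ²`** at a diagonal maximiser (apply the previous bound to `ᵗB`). [folklore] -/
theorem normSq_ge_kappa_sq {u₁ u₂ v₁ v₂ : Fin 3 → ℝ} (hu₁ : u₁ ⬝ᵥ u₁ = 1) (hu₂ : u₂ ⬝ᵥ u₂ = 1)
    (hu : u₁ ⬝ᵥ u₂ = 0) (hv₁ : v₁ ⬝ᵥ v₁ = 1) (hv₂ : v₂ ⬝ᵥ v₂ = 1) (hv : v₁ ⬝ᵥ v₂ = 0)
    (hmax : ∀ u₁' u₂' v₁' v₂' : Fin 3 → ℝ, u₁' ⬝ᵥ u₁' = 1 → u₂' ⬝ᵥ u₂' = 1 → u₁' ⬝ᵥ u₂' = 0 →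
      v₁' ⬝ᵥ v₁' = 1 → v₂' ⬝ᵥ v₂' = 1 → v₁' ⬝ᵥ v₂' = 0 →
      u₁' ⬝ᵥ (B *ᵥ v₁') + u₂' ⬝ᵥ (B *ᵥ v₂') ≤ u₁ ⬝ᵥ (B *ᵥ v₁) + u₂ ⬝ᵥ (B *ᵥ v₂))
    (hdiag : u₁ ⬝ᵥ (B *ᵥ v₂) = 0) (e : Fin 3 → ℝ) (he : e ⬝ᵥ e = 1) :
    ((u₁ ⨯₃ u₂) ⬝ᵥ (B *ᵥ (v₁ ⨯₃ v₂))) ^ 2 ≤ (B *ᵥ e) ⬝ᵥ (B *ᵥ e) := by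
  have hmaxT := kyFanMax_transpose hmax
  have hsymm := kyFanMax_symm hu₁ hu₂ hu hv₁ hv₂ hv hmax
  have hdiagT : v₁ ⬝ᵥ (Bᵀ *ᵥ u₂) = 0 := by rw [Matrix.dotProduct_transpose_mulVec, hsymm]; exact hdiag
  have h := normSq_transpose_ge_kappa_sq (B := Bᵀ) hv₁ hv₂ hv hu₁ hu₂ hu hmaxT hdiagT e he
  rw [Matrix.transpose_transpose, Matrix.dotProduct_transpose_mulVec] at h
  -- `κ(ᵗB) = v₀ᵀ ᵗB u₀ = u₀ᵀ B v₀`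
  rwa [dotProduct_comm] at h ⊢

/-- **`X' ≥ 2(Mᴬ + |κ|) X` at the minimising pair** (Hamilton's `d ln(a₁ + a₂) ≥ 2a₃ + 2b₁ +
(non-negative)/(a₁ + a₂)`): for symmetric `A`, a critical orthonormal pair `(w, w')` with normal
`n` whose Rayleigh quotient `Mᴬ = nᵀAn` and with `|ᵗBw|², |ᵗBw'|² ≥ κ²`.
[cite: Hamilton1997, §2.1, Thm. 1.3 (proof, p. 8)] -/
theorem pairMin_lower (hA : A.IsSymm) {w w' n : Fin 3 → ℝ} {κ : ℝ} (hw : w ⬝ᵥ w = 1)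
    (hw' : w' ⬝ᵥ w' = 1) (hn : n ⬝ᵥ n = 1) (hww' : w ⬝ᵥ w' = 0) (hwn : w ⬝ᵥ n = 0) (hw'n : w' ⬝ᵥ n = 0)
    (hXw : w ⬝ᵥ (A *ᵥ n) = 0) (hXw' : w' ⬝ᵥ (A *ᵥ n) = 0)
    (hkw : κ ^ 2 ≤ (Bᵀ *ᵥ w) ⬝ᵥ (Bᵀ *ᵥ w)) (hkw' : κ ^ 2 ≤ (Bᵀ *ᵥ w') ⬝ᵥ (Bᵀ *ᵥ w')) :
    2 * (n ⬝ᵥ (A *ᵥ n) + |κ|) * (w ⬝ᵥ (A *ᵥ w) + w' ⬝ᵥ (A *ᵥ w')) ≤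
      w ⬝ᵥ ((A * A + B * Bᵀ + (2 : ℝ) • A.sharp) *ᵥ w) +
        w' ⬝ᵥ ((A * A + B * Bᵀ + (2 : ℝ) • A.sharp) *ᵥ w') := by
  rw [pairSum_field_eq (B := B) hA hw hw' hn hww' hwn hw'n hXw hXw',
    normSq_pair_eq hA hw hw' hn hww' hwn hw'n hXw hXw']
  have hk2 : |κ| ^ 2 = κ ^ 2 := sq_abs κ
  nlinarith [sq_nonneg (w ⬝ᵥ (A *ᵥ w) - |κ|), sq_nonneg (w' ⬝ᵥ (A *ᵥ w') - |κ|),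
    sq_nonneg (w ⬝ᵥ (A *ᵥ w')), abs_nonneg κ]

/-- **The bookkeeping of Hamilton's proof of Thm. 1.3**: from `Y' ≤ (Mᴬ + Mᶜ + 2k) Y` (`Y ≥ 0`),
`X' ≥ 2(Mᴬ + k) X`, `X_C' ≥ 2(Mᶜ + k) X_C` (`X, X_C ≥ 0`, `Λ ≥ 0`):
`Λ(X'X_C + XX_C') - 2YY' ≥ 2(Mᴬ + Mᶜ + 2k)(ΛXX_C - Y²)`. [cite: Hamilton1997, §2.1, Thm. 1.3 (proof, p. 8)] -/
theorem twoSingular_scalar {Λ X XC X' XC' Y Y' MA MC k : ℝ} (hΛ : 0 ≤ Λ) (hX : 0 ≤ X) (hXC : 0 ≤ XC)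
    (hY : 0 ≤ Y) (hY' : Y' ≤ (MA + MC + 2 * k) * Y) (hX' : 2 * (MA + k) * X ≤ X')
    (hXC' : 2 * (MC + k) * XC ≤ XC') :
    2 * (MA + MC + 2 * k) * (Λ * X * XC - Y ^ 2) ≤ Λ * (X' * XC + X * XC') - 2 * Y * Y' := by
  have h1 := mul_le_mul_of_nonneg_right hX' hXC
  have h2 := mul_le_mul_of_nonneg_left hXC' hX
  have h3 := mul_le_mul_of_nonneg_left hY' hY
  nlinarith [mul_le_mul_of_nonneg_left (add_le_add h1 h2) hΛ]

end HamiltonODE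

end Literature.Geometry.Riemannian

end
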